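import Summits.QuantumFields.YangMills.Theorems.UnitScaleTiltProp7SectET3N06LeavesRecord
import Summits.QuantumFields.YangMills.Theorems.UnitScaleTiltProp7SectET3G0LayerFromThm310E
import Summits.QuantumFields.YangMills.Theorems.UnitScaleTiltProp7SectET3StepDirLayerFromLetters
import Summits.QuantumFields.YangMills.Theorems.UnitScaleTiltProp7SectET3KernelFamilyCanonical
import Summits.QuantumFields.YangMills.Theorems.UnitScaleTiltProp7SectET3OpsSymmetry
import Summits.QuantumFields.YangMills.Theorems.UnitScaleTiltProp7SectET3ClassTransferRows
import HarnessLib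

/-!
# Route `UnitScaleTilt` (α), node N06(d = 3) — **THE `norm_G` ROW OF C-min WITH ALL THREE BOOKKEEPING REDUCTIONS AT ONCE**: the Sect.-D step rows DERIVED from the
# letter layer (ym-inputs-p03 ✓ p619835 ∕ p620312), the kernel family + six co-reading rows + symmetry row + (3.47) pin DISCHARGED from K-free evaluation rows
# (ym-inputs-p05 ✓ p618955 ∕ p618608 ∕ p619368), and the class-transfer input in the print-faithful ∃-shape (BG-336)′ (ym-inputs-p06 ✓ p619973, p05 ✓ p620668)

Cell `ym-inputs` (D-0154 (2); desk `ym-inputs-plan-1` INPUT-LIST v7 §4 row p03 = I-06 (b) + «optional follow-up: the `hCT`-free twin of `normG_row_of_letterLayers`»), seat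
ym-inputs-p03 gen 2.  Count-neutral helper (`--supports stmt-QuantumFields-20520 --as helper`; RULING g26-№2 «B0 of (O″χ) needs N06(d = 3)»); registry untouched; THEOREMS ONLY
(0 `def`, 0 `sorry`); NOTHING of [Balaban1985BackgroundPropagators] is asserted.

WHAT.  ★★★ `normG_row_of_letterLayers_evaluationRowsS` is the `norm_G` row of the EX knit (`Prop7StubEXOfChartPieces*`'s binder `norm_G`, conclusion VERBATIM as in the text of
record ✓ p605632 `Prop7SectET3N06LeavesRecordNormG.normG_row_of_recordObligations`) with the THREE reductions this desk's wave produced composed in ONE kernel statement: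
(i) p03's letter layer — `hmodel` (Thm33G0 ∧ Step ∧ Step ∧ FormSmall ∧ Identities), `hleft` (LeftStep), `hG0C` (Thm33G0Dir ∧ DirR), `hG0L2`, `hstepD` (StepDirB) are NOT
displayed; displayed instead are Theorem 3.10's schemas for `G₀ = G(U)` (`h36A h36HA h36A2` + static data) and print's (3.131)∕(3.137) letter schemas `hL3131 hL3131H hR`, `hX`,
`hdiv`, the R2-loc facts `hvanishX hleX` at `RelB`, `hpos12`, `hinv12`, `hIdOfForm`, `hstepL2` (face-E layer ✓ `g0_layer_T3_of_thm310_coreB` ∘ StepDir layer ✓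
`stepDirB_layer_T3_of_lettersCZ`, exactly as in ✓ `t313_of_pins_T3_completePairMBZ_ofLetterLayers`); (ii) p05's structural reduction — the kernel family `GG`, the six
co-reading rows `hcoR hco1R hcoG hl2N hH1N hIF`, the symmetry row `hsymGG` and the (3.47) pin `hglob` are NOT displayed; displayed instead are the TEN K-free evaluation rows
`hoff … hlocle` of the instance's `ev`∕`evY`∕`bHXA`, ONE letter-symmetry row `hls` (Δ_a, Δ′_π, Δ⁽²⁾_π symmetric; ∇*_U = ∇_Uᵗ) and ONE readout row `hread` (✓
`exists_kernelFamily_structural`, ✓ `hsymGG_row_of_letterSymm` — the `Identities` it needs is the DERIVED fifth conjunct of the face-E layer's `hmodel`, so no `Identities` row is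
displayed either); (iii) p06's class-transfer shape — `hCT : ClassTransferT3 ℓ hL c35` (the ∀-α₀ row, typing flag (F1)∕§5 8b of INPUT-LIST, unsupplied by print) is replaced by
the ∃-shape `hCTS`, which ✓ `Prop7SectET3ClassTransfer.reg335_reg336_T3_of_regPr` DISCHARGES for every leaf constant `c35 ≥ c35₀(L)` ([Balaban1985RegularSpaces] Prop. 6 at the
T³ class).  Every other binder of the record leaf VERBATIM (letter record `𝔬12`, Z-letters `hletters hlettersD hLHH hLH3 hLL2`, input letters `hLIM`, numerics); pins
`HasRWExpOfOps`∕`PosDefKOfOps` canonical (as in p05's F3∕F6).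
NET: of the twenty-odd displayed rows of the text of record, what remains displayed for the `norm_G` storey is exactly the INSTANCE-BOUND layer-0 material (p01's L0a–L0f + p05's
`…OpsT3*Rows`): Theorem 3.10's schemas at the concrete `𝔬A`, the (3.131)∕(3.137)∕(3.126)∕(3.132) letters at the concrete `𝔬12`, evaluation facts of the concrete `ev`∕`evY`, and `hCTS`
(dischargeable BY NAME).  L-FLOOR (RULING g26-№20, INPUT-LIST §5 item 9): the conclusion quantifies `∀ (hℓ : 4 ≤ ℓ) … (hM8 : 8 ≤ (ℓ+1)^a′)` = L ≥ 5 content (LF-1 root via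
`memberIdx`); NOTHING is delivered at L = 3.  LETTER SPECIES (RULING g26-№21 (5), memo `pub/ym-inputs/N06-RECUT-TWIN-LOCATE-p03g2.md`): `hletters`∕`hLL2` still carry the three
located fields `rgd1`∕`ddGDv`∕`rgdDds` VERBATIM (a weaker-hypothesis twin waits on the Literature re-thread L0–L7 of that memo).
HONEST SCOPE: bookkeeping (two `obtain`, a `choose`, three `have`, one `exact`); every schema ∕ letter ∕ evaluation row stays a displayed HYPOTHESIS about the genuine operators;
N06(d = 3) NOT discharged; nothing here claims EX, the crux, V3∕R3, d = 4 or the mass gap; YM₃ on T³ is ladder rung R3 (RECORD), not the Clay problem.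

References: T. Bałaban, CMP **99** (1985) 389–434 [Balaban1985BackgroundPropagators] (Thm 3.13 p.426, Thm 3.10 pp.414–416, (3.42)–(3.47) pp.397–398, (3.130)–(3.138) pp.421–423,
(3.153) p.426); CMP **102** (1985) 277–309 [Balaban1985Variational] ((14) p.280, (115)–(117) pp.294–295); CMP **99** (1985) 75–102 [Balaban1985RegularSpaces] ((1.33) p.82,
Prop. 6 p.99); CMP **96** (1984) 223–250 [Balaban1984PropagatorsII] (Lemma 2.1 (2.59)–(2.61) pp.233–234).
-/

set_option autoImplicit false

noncomputable section

open scoped Matrix.Norms.L2Operator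

namespace Summit.QuantumFields.YangMills.Theorems.Prop7SectET3N06LeavesRecordStepLayerEvalRowsS
open Literature.MathematicalPhysics.QuantumFieldTheory.Balaban1983to89
open Finset B6RandomWalk B6RandomWalkHom B9Thm34Ext B9Thm37GlueCor36 B11SectG B9SectDSup B9Thm37AllNorms
open B9Thm37AllNormsInstances B9FromB6 B9FromB6ModelSignsOn B9SectBStepWhole B9Thm312Whole B9Thm312WholeLeaf B9Thm312WholeLeft B9Thm313Whole
open B9Thm313WholeLeft B9Thm312WholeLeafLeftGlob B9Ineq347CoReading B9SectCDiffDict B9CoRealizesRel B9Thm37Glue B9SectDL2Decay B9RWSums343Holder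
open B9RWSumsReadsRel B9RWSumsReadsNbr B9Ineq347 B9Thm312WholeClasses B9Thm312WholeL2 B9Thm312WholeBlocksRel B9Thm312WholeBlocksNbr B9Thm313WholeLeafRel
open B9Thm312WholeHolder B9Thm312WholeHHolder B9Thm313WholeHolder B9Thm313WholeL2G B9Thm313WholeL2GP B9Thm313WholeInput B9Thm313WholeBlocksNbr B9Thm312WholeLeafAll
open B9RWSums346SecondDiff B9Thm313WholeBlocksNbrRec B9RWSums344InputFam B9Thm312WholeDir B9Thm312WholeBlocksPairM B9Thm313WholeDir B9Thm313WholeDirInput B9Thm313WholeBlocksPairM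
open B9Thm313WholeLeafCompletePairM B9Thm312WholeDirB B9Thm313WholeDirInputB B9Thm313WholeBlocksPairMB B9Thm313WholeLeafCompletePairMB B9Thm313WholeBlocksPairMZ B9Thm313WholeBlocksPairMBZ B9Thm313WholeLeafRelZ
open B9Thm312WholeHZ B9Thm313WholeZ B9Thm313WholeLeftZ B9Thm313WholeHolderZ B9Thm313WholeInputZ B9Thm313WholeDirZ B9Thm313WholeDirInputZ B9Thm313WholeDirInputBZ
open B9Thm313WholeL2GZ B9Thm313WholeL2GPZ B9Thm313WholeDirL2Z B9Thm313WholeLeafCompletePairMBZ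
open B6KLevelCensusIndexV1 (KIdx)
open B9GeoNormsKLevelV1 (geo9K)
open B9CoRealizesRelAtLetters (RelB)
open B9GeoLemma21KLevelV1 (geo9K_len_pos)
open B9Thm310Whole (Ops310 StaticOK310 Sizes310 Local342G Identities310)
open B9RWSums344InputPair (InputLegsPair310 FactorsInputPair310 DirSupHolder310)
open B9RWSums346MixedPair (L2MixedLegs310 FactorsL2Mixed310 DirSup310)
open B9RWSums346Two (L2TwoLegs310 FactorsL2_310)
open B9RWSumsDefinitePins (PinPrims)
open B9RWSumsDefinitePinsPair (PairPrims)
open B9RWSumsDefinitePinsPairM (MixedPrims)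
open B9Thm312WholeStepFrom3131 (Letters3131)
open B9Thm312WholeLeftStepFrom3131 (Letters3131H)
open B9Thm312WholeStepDirFrom3131 (Thm33G0DirX)
open B9Thm312WholeRightStepFrom3131 (Letters3131R Thm33G0DivR)
open Summit.QuantumFields.YangMills.Theorems.Prop7SectET3Members (hd3)
open Summit.QuantumFields.YangMills.Theorems.Prop7SectET3Geometry (geoOK_geo9K)
open Summit.QuantumFields.YangMills.Theorems.Prop7SectET3BgClass (bgT3)
open Summit.QuantumFields.YangMills.Theorems.Prop7SectET3Letters (LettersRowZT3)
open Summit.QuantumFields.YangMills.Theorems.Prop7SectET3N06LeavesRecord (t313_of_pins_T3_completePairMBZ)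
open Summit.QuantumFields.YangMills.Theorems.Prop7SectET3G0LayerFromThm310E (g0_layer_T3_of_thm310_coreB)
open Summit.QuantumFields.YangMills.Theorems.Prop7SectET3StepDirLayerFromLetters (stepDirB_layer_T3_of_lettersCZ relB_mult_real dist_eq_of_relB_right)
open B9GeoNormsKLevelModelSignsV1 (modelSignsOn_geo9K)
open Summit.QuantumFields.YangMills.Theorems.Prop7SectET3Members (memberIdx)
open Summit.QuantumFields.YangMills.Theorems.Prop7SectET3BgClass (cfgV1OfT3)
open Summit.QuantumFields.YangMills.Theorems.Prop7SectET3ClassTransferRows (normG_row_of_t313_classTransferS)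
open Summit.QuantumFields.YangMills.Theorems.Prop7SectET3KernelFamilyCanonical (exists_kernelFamily_structural)
open Summit.QuantumFields.YangMills.Theorems.Prop7SectET3OpsSymmetry (hsymGG_row_of_letterSymm)
open T3ContinuumYM3Torus T3PrintedRegularMinimiser B6GlobalChartV1

variable {ℓ : ℕ} {hL : Odd (ℓ + 1) ∧ 1 < ℓ + 1} {c35 : ℝ}

set_option maxHeartbeats 400000 in
/-- ★★★ **THE `norm_G` ROW OF C-min FROM THEOREM 3.10's SCHEMAS + THE SECT.-D LETTER LAYER + K-FREE EVALUATION ROWS + ONE LETTER-SYMMETRY ROW + ONE READOUT ROW + (BG-336)′**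
(module docstring): `normG_row_of_t313_classTransferS` ∘ `t313_of_pins_T3_completePairMBZ` with `hmodel hleft hG0C hG0L2 hstepD` SUPPLIED by `g0_layer_T3_of_thm310_coreB` (face E)
and `stepDirB_layer_T3_of_lettersCZ` (at `Rel := RelB`, multiplicity 6), with `GG hcoR hco1R hcoG hl2N hH1N hIF` SUPPLIED by `exists_kernelFamily_structural` from the evaluation rows,
`hsymGG` by `hsymGG_row_of_letterSymm` from the DERIVED `Identities` and `hls`, `hglob` from the dominations and `hread`, and the class-transfer input in the ∃-shape `hCTS`; band
`b₀ = b₁ = 1`; the leaf is read at the layers' thresholds `(M₀′, a₀)`.  Conclusion VERBATIM = the EX knit's `norm_G` row.  Nothing of print asserted; NOT a discharge of N06(d = 3);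
nothing at L = 3 (`4 ≤ ℓ` in the conclusion).
[cite: Balaban1985Variational, (117) p.295, (14) p.280; Balaban1985BackgroundPropagators, Thm 3.13 p.426, Thm 3.10 (3.105)-(3.108) pp.414-416, (3.47) p.398, (3.130)-(3.138) pp.421-423; Balaban1985RegularSpaces, (1.33) p.82, Prop. 6 p.99; Balaban1984PropagatorsII, Lemma 2.1 (2.59)-(2.61) pp.233-234] -/
theorem normG_row_of_letterLayers_evaluationRowsS
    [∀ i : KIdx 2 ℓ hd3 hL 1 1, Fintype (geo9K i).Site] [∀ i : KIdx 2 ℓ hd3 hL 1 1, DecidableEq (geo9K i).Site]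
    [∀ i : KIdx 2 ℓ hd3 hL 1 1, DecidableRel (RelB i)]
    {X Y ι A PX PY Z W : KIdx 2 ℓ hd3 hL 1 1 → Type} {P : Type}
    [∀ x, Fintype (X x)] [∀ x, DecidableEq (X x)] [∀ x, Fintype (Y x)] [∀ x, DecidableEq (Y x)] [∀ x, Fintype (ι x)]
    [∀ x, Fintype (A x)] [∀ x, Fintype (PX x)] [∀ x, DecidableEq (PX x)] [∀ x, Fintype (PY x)] [∀ x, DecidableEq (PY x)]
    [∀ x, Fintype (Z x)] [∀ x, Fintype (W x)] [Fintype P]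
    (hc35 : 0 < c35) (q : PinPrims) (hq : q.OK) (q3 : PairPrims) (hq3 : q3.OK) (qM : MixedPrims) (hqM : qM.OK)
    (H : KIdx 2 ℓ hd3 hL 1 1 → Prop)
    -- ======== Theorem 3.10's letters and schemas for G₀ = G(U) (rows 18–19, G side), as in ★w1's `…N06LeavesRelZFromThm310` ========
    (𝔬A : ∀ x : KIdx 2 ℓ hd3 hL 1 1, Ops310 (geo9K x) (bgT3 x) (X x) (Y x) (ι x) (A x))
    (𝔭A : ∀ x : KIdx 2 ℓ hd3 hL 1 1, HolderProbes (geo9K x) (bgT3 x) (X x) (Y x) (PX x) (PY x))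
    (𝔡A : ∀ x : KIdx 2 ℓ hd3 hL 1 1, DirOps310 (𝔬A x) P)
    (bHXA : ∀ x : KIdx 2 ℓ hd3 hL 1 1, ℝ → BlockNorm (toB6 (geo9K x) 1 (H x)) (X x → ℝ))
    (κA : KIdx 2 ℓ hd3 hL 1 1 → Sizes310)
    (SHA S3A SIA SMA S2A : ∀ x : KIdx 2 ℓ hd3 hL 1 1, ι x → Finset (geo9K x).Site)
    (hstA : ∀ x, StaticOK310 (𝔬A x) q.ρ q.Nc q.N' q.NF q.Cℓ (κA x)) (hκA : ∀ x, (κA x).Bounded q.Kc)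
    (h36A : ∀ x, q.M₁ ≤ (geo9K x).M → ∀ α₀ : ℝ, 0 < α₀ → c35 * (geo9K x).M * α₀ ≤ q.a₁ →
      ∀ U : (bgT3 x).Cfg, (bgT3 x).Reg335 c35 α₀ U →
        Local342G (𝔬A x) 1 (H x) q.B₀ q.δ₀ U ∧ B9Thm310Whole.Factors389 (𝔬A x) 1 (H x) q.θ₀ q.δ₀ U ∧
          Identities310 (𝔬A x) 1 (H x) U)
    (h36HA : ∀ x, q.M₁ ≤ (geo9K x).M → ∀ α₀ : ℝ, 0 < α₀ → c35 * (geo9K x).M * α₀ ≤ q.a₁ →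
      ∀ U : (bgT3 x).Cfg, (bgT3 x).Reg335 c35 α₀ U →
        HolderLegs310 (𝔬A x) (𝔭A x) 1 (H x) (SHA x) q.Bl q.δ₀ U ∧ FactorsHolder310 (𝔬A x) (𝔭A x) 1 (H x) q.Bt q.δ₀ U ∧
          (L2SecondLegs310 (𝔬A x) (𝔡A x) 1 (H x) (S3A x) q3.B3 q.δ₀ U ∧ FactorsL2Second310 (𝔬A x) (𝔡A x) 1 (H x) q3.θ3 q.δ₀ U ∧
            DirTranspose310 (𝔬A x) (𝔡A x) U) ∧
            (InputLegsPair310 (𝔬A x) (𝔡A x) (𝔭A x) 1 (H x) (bHXA x) (SIA x) q.BI q.BI2 q.δ₀ U ∧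
              FactorsInputPair310 (𝔬A x) (𝔡A x) 1 (H x) (bHXA x) q.θI q.δ₀ U ∧ DirSupHolder310 (𝔬A x) (𝔡A x) (𝔭A x) 1 (H x) U) ∧
              (L2MixedLegs310 (𝔬A x) (𝔡A x) 1 (H x) (SMA x) qM.BM q.δ₀ U ∧ FactorsL2Mixed310 (𝔬A x) (𝔡A x) 1 (H x) qM.θM q.δ₀ U ∧
                DirSup310 (𝔬A x) (𝔡A x) 1 (H x) U))
    (h36A2 : ∀ x, q.M₁ ≤ (geo9K x).M → ∀ α₀ : ℝ, 0 < α₀ → c35 * (geo9K x).M * α₀ ≤ q.a₁ →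
      ∀ U : (bgT3 x).Cfg, (bgT3 x).Reg335 c35 α₀ U →
        L2TwoLegs310 (𝔬A x) 1 (H x) (S2A x) q.B2 q.δ₀ U ∧ FactorsL2_310 (𝔬A x) 1 (H x) q.θ2 q.δ₀ U)
    (hcntHA : ∀ x (a : (geo9K x).Site), (∑ c, if a ∈ SHA x c then (1 : ℝ) else 0) ≤ q.NH)
    (hcnt3A : ∀ x (a : (geo9K x).Site), (∑ c, if a ∈ S3A x c then (1 : ℝ) else 0) ≤ q3.N3)
    (hcntIA : ∀ x (a : (geo9K x).Site), (∑ c, if a ∈ SIA x c then (1 : ℝ) else 0) ≤ q.NI)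
    (hcntMA : ∀ x (a : (geo9K x).Site), (∑ c, if a ∈ SMA x c then (1 : ℝ) else 0) ≤ qM.NM)
    (hcnt2A : ∀ x (a : (geo9K x).Site), (∑ c, if a ∈ S2A x c then (1 : ℝ) else 0) ≤ q.N2)
    (hsymA : ∀ x, q.M₁ ≤ (geo9K x).M → ∀ α₀ : ℝ, 0 < α₀ → c35 * (geo9K x).M * α₀ ≤ q.a₁ →
      ∀ U : (bgT3 x).Cfg, (bgT3 x).Reg335 c35 α₀ U → IsTransposePair ((𝔬A x).G U) ((𝔬A x).G U))
    (htrA : ∀ x, q.M₁ ≤ (geo9K x).M → ∀ α₀ : ℝ, 0 < α₀ → c35 * (geo9K x).M * α₀ ≤ q.a₁ →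
      ∀ U : (bgT3 x).Cfg, (bgT3 x).Reg335 c35 α₀ U →
        IsTransposePair ((𝔬A x).D U ∘ₗ (𝔬A x).G U) ((𝔬A x).G U ∘ₗ (𝔬A x).Dstar U))
    -- ======== the Theorem-3.12 letter record of the leaf and the identification G₀ := G(U) ========
    (𝔬12 : ∀ x : KIdx 2 ℓ hd3 hL 1 1, B9Thm312Whole.Ops (geo9K x) (bgT3 x) (X x) (Y x) (Z x) (W x))
    (hblk : ∀ x, (𝔬12 x).blk = (𝔬A x).blk) (hblkY : ∀ x, (𝔬12 x).blkY = (𝔬A x).blkY)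
    (hG0 : ∀ x (U : (bgT3 x).Cfg), (𝔬12 x).G0 U = (𝔬A x).G U) (hD : ∀ x (U : (bgT3 x).Cfg), (𝔬12 x).D U = (𝔬A x).D U)
    (hDs : ∀ x (U : (bgT3 x).Cfg), (𝔬12 x).Dstar U = (𝔬A x).Dstar U)
    -- ======== the Sect.-D numerics (regime (M12, a12) of the displayed rows; the rates with their ONE relation) ========
    (θ2₁₂ δ12₀ δK12 a12 M12 B12₃ δ12₃ t12 δT12 ρS σS κ₀ : ℝ) (ha12 : 0 < a12) (hM12 : 0 < M12) (hθ2₁₂ : 0 ≤ θ2₁₂)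
    (hδ12₀ : δ12₀ ≤ (1 - 3 * q.αF) * ((1 - 2 * q.α) * q.δ₀)) (hB12₃ : 0 ≤ B12₃) (ht12 : 0 ≤ t12)
    (bH13 : ∀ x : KIdx 2 ℓ hd3 hL 1 1, BlockNorm (toB6 (geo9K x) 1 (H x)) (W x → ℝ)) (hκ13 : ∀ x, (bH13 x).κ ≤ κ₀)
    (bHW13 : ∀ x : KIdx 2 ℓ hd3 hL 1 1, ℝ → BlockNorm (toB6 (geo9K x) 1 (H x)) (W x → ℝ)) (hκW : ∀ (x : KIdx 2 ℓ hd3 hL 1 1) (ε : ℝ), (bHW13 x ε).κ ≤ κ₀)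
    (hσS : 0 < σS) (hρS : 0 ≤ ρS) (hρST : ρS ≤ δT12) (hρS₀ : ρS + σS ≤ δ12₀) (hρS₃ : ρS + σS ≤ δ12₃)
    (hδKS : δK12 + q.αF * ((1 - 2 * q.α) * q.δ₀) ≤ ρS) (hσSK : σS ≤ δK12) (hδK0 : 0 ≤ δK12)
    -- ======== the letter layer replacing `hmodel`∕`hleft`∕`hG0C`∕`hstepD` ========
    (hpos12 : ∀ x : KIdx 2 ℓ hd3 hL 1 1, M12 ≤ (geo9K x).M → ∀ α₀ : ℝ, 0 < α₀ → (geo9K x).M * α₀ ≤ a12 →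
      ∀ U : (bgT3 x).Cfg, (bgT3 x).Reg335 c35 α₀ U → (bgT3 x).Reg336 c35 α₀ U → PosDefEnd ((𝔬12 x).S0 U))
    (hinv12 : ∀ x : KIdx 2 ℓ hd3 hL 1 1, M12 ≤ (geo9K x).M → ∀ α₀ : ℝ, 0 < α₀ → (geo9K x).M * α₀ ≤ a12 →
      ∀ U : (bgT3 x).Cfg, (bgT3 x).Reg335 c35 α₀ U → (bgT3 x).Reg336 c35 α₀ U → (𝔬12 x).G0 U * (𝔬12 x).S0 U = 1)
    (hIdOfForm : ∀ x : KIdx 2 ℓ hd3 hL 1 1, M12 ≤ (geo9K x).M → ∀ α₀ : ℝ, 0 < α₀ → (geo9K x).M * α₀ ≤ a12 →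
      ∀ U : (bgT3 x).Cfg, (bgT3 x).Reg335 c35 α₀ U → (bgT3 x).Reg336 c35 α₀ U →
        ∀ r : ℝ, r < 1 → FormSmall (𝔬12 x) r U → B9Thm312Whole.Identities (𝔬12 x) U)
    (Ta Ta₂ Ta' Ta₂' : ∀ x : KIdx 2 ℓ hd3 hL 1 1, (bgT3 x).Cfg → Module.End ℝ (X x → ℝ))
    (Tb Tb₂ : ∀ x : KIdx 2 ℓ hd3 hL 1 1, (bgT3 x).Cfg → (X x → ℝ) →ₗ[ℝ] (W x → ℝ))
    (Tb' Tb₂' : ∀ x : KIdx 2 ℓ hd3 hL 1 1, (bgT3 x).Cfg → (W x → ℝ) →ₗ[ℝ] (X x → ℝ))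
    (hL3131 : ∀ x : KIdx 2 ℓ hd3 hL 1 1, M12 ≤ (geo9K x).M → ∀ α₀ : ℝ, 0 < α₀ → (geo9K x).M * α₀ ≤ a12 →
      ∀ U : (bgT3 x).Cfg, (bgT3 x).Reg335 c35 α₀ U → (bgT3 x).Reg336 c35 α₀ U →
        Letters3131 (𝔬12 x) (Ta x) (Ta₂ x) (Tb x) (Tb₂ x) 1 (H x) (fun y => (geo9K_len_pos x y).le) (t12 * ((geo9K x).M * α₀)) δT12 U)
    (hL3131H : ∀ x : KIdx 2 ℓ hd3 hL 1 1, M12 ≤ (geo9K x).M → ∀ α₀ : ℝ, 0 < α₀ → (geo9K x).M * α₀ ≤ a12 →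
      ∀ U : (bgT3 x).Cfg, (bgT3 x).Reg335 c35 α₀ U → (bgT3 x).Reg336 c35 α₀ U →
        Letters3131H (𝔬12 x) (Tb x) (Tb₂ x) 1 (H x) (fun y => (geo9K_len_pos x y).le) (bH13 x) (t12 * ((geo9K x).M * α₀)) δT12 U)
    (hR : ∀ x : KIdx 2 ℓ hd3 hL 1 1, M12 ≤ (geo9K x).M → ∀ α₀ : ℝ, 0 < α₀ → (geo9K x).M * α₀ ≤ a12 →
      ∀ U : (bgT3 x).Cfg, (bgT3 x).Reg335 c35 α₀ U → (bgT3 x).Reg336 c35 α₀ U →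
        Letters3131R (𝔬12 x) (Ta' x) (Ta₂' x) (Tb' x) (Tb₂' x) 1 (H x) (fun y => (geo9K_len_pos x y).le) (t12 * ((geo9K x).M * α₀)) δT12 U)
    (hstepL2 : ∀ x : KIdx 2 ℓ hd3 hL 1 1, M12 ≤ (geo9K x).M → ∀ α₀ : ℝ, 0 < α₀ → (geo9K x).M * α₀ ≤ a12 →
      ∀ U : (bgT3 x).Cfg, (bgT3 x).Reg335 c35 α₀ U → (bgT3 x).Reg336 c35 α₀ U →
        StepL2 (𝔬12 x) 1 (H x) (θ2₁₂ * ((geo9K x).M * α₀)) δK12 U)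
    (Bq12 BhD13 Bx13 Bx0 BdX BiD BdD : ℝ → ℝ)
    (hBq12 : ∀ β, 0 ≤ β → β < 1 → 0 ≤ Bq12 β) (hBhD13 : ∀ β, 0 ≤ β → β < 1 → 0 ≤ BhD13 β) (hBx13 : ∀ β, 0 ≤ β → β < 1 → 0 ≤ Bx13 β)
    (hBx0 : ∀ β, 0 ≤ β → β < 1 → 0 ≤ Bx0 β) (hBdX : ∀ β, 0 ≤ β → β < 1 → 0 ≤ BdX β) (hBiD : ∀ ε, 0 < ε → 0 ≤ BiD ε)
    (hX : ∀ x : KIdx 2 ℓ hd3 hL 1 1, M12 ≤ (geo9K x).M → ∀ α₀ : ℝ, 0 < α₀ → (geo9K x).M * α₀ ≤ a12 →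
      ∀ U : (bgT3 x).Cfg, (bgT3 x).Reg335 c35 α₀ U → (bgT3 x).Reg336 c35 α₀ U →
        Thm33G0DirX (𝔬12 x) (𝔭A x) (𝔡A x).Dd 1 (H x) (fun y => (geo9K_len_pos x y).le) (bH13 x) Bx0 BdX δ12₀ δ12₃ U)
    (hdiv : ∀ x : KIdx 2 ℓ hd3 hL 1 1, M12 ≤ (geo9K x).M → ∀ α₀ : ℝ, 0 < α₀ → (geo9K x).M * α₀ ≤ a12 →
      ∀ U : (bgT3 x).Cfg, (bgT3 x).Reg335 c35 α₀ U → (bgT3 x).Reg336 c35 α₀ U →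
        Thm33G0DivR (𝔬12 x) (𝔡A x).Dsd 1 (H x) (fun y => (geo9K_len_pos x y).le) (bHXA x) (bHW13 x) BiD BdD δ12₀ δ12₃ U)
    (hvanishX : ∀ x : KIdx 2 ℓ hd3 hL 1 1, M12 ≤ (geo9K x).M → ∀ α₀ : ℝ, 0 < α₀ → (geo9K x).M * α₀ ≤ a12 →
      ∀ U : (bgT3 x).Cfg, (bgT3 x).Reg335 c35 α₀ U → (bgT3 x).Reg336 c35 α₀ U →
        ∀ ε : ℝ, 0 < ε → ∀ (y' : (geo9K x).Site) (μ : X x → ℝ), (bHXA x ε).IsLoc y' μ → ∀ y'' : (geo9K x).Site, ¬ RelB x y'' y' →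
          (BlockNorm.ofBlocks (toB6 (geo9K x) 1 (H x)) (𝔬12 x).blk).cut y'' μ = 0)
    (hleX : ∀ x : KIdx 2 ℓ hd3 hL 1 1, M12 ≤ (geo9K x).M → ∀ α₀ : ℝ, 0 < α₀ → (geo9K x).M * α₀ ≤ a12 →
      ∀ U : (bgT3 x).Cfg, (bgT3 x).Reg335 c35 α₀ U → (bgT3 x).Reg336 c35 α₀ U →
        ∀ ε : ℝ, 0 < ε → ∀ (y' : (geo9K x).Site) (μ : X x → ℝ), (bHXA x ε).IsLoc y' μ → ∀ y'' : (geo9K x).Site, RelB x y'' y' →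
          (BlockNorm.ofBlocks (toB6 (geo9K x) 1 (H x)) (𝔬12 x).blk).loc y'' ((BlockNorm.ofBlocks (toB6 (geo9K x) 1 (H x)) (𝔬12 x).blk).cut y'' μ) ≤ (bHXA x ε).loc y' μ)
    -- ======== the leaf's evaluation maps and numerics, VERBATIM (`Prop7SectET3N06LeavesRecord.t313_of_pins_T3_completePairMBZ`) ========
    (ev : ∀ x : KIdx 2 ℓ hd3 hL 1 1, (geo9K x).Loc → X x → ℝ) (evY : ∀ x : KIdx 2 ℓ hd3 hL 1 1, (geo9K x).Loc → Y x → ℝ)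
    (r Cev B₄ σ ρ ρ' α : ℝ) (Bd θV Br : ℝ → ℝ) (Bd2 : ℝ → ℝ → ℝ)
    (hθV : ∀ ε, 0 < ε → 0 ≤ θV ε) (hB₄ : 0 ≤ B₄) (hBr : ∀ ε, 0 < ε → 0 ≤ Br ε) (hσ : 0 < σ) (hρ' : 0 < ρ') (hρ'ρ : ρ' + 3 * σ ≤ ρ)
    (hρ'ρ₅ : ρ' + 5 * σ ≤ ρ) (hσρ' : 3 * σ < (1 - α) * ρ') (hρ0 : ρ ≤ δ12₀) (hρ₃ : ρ ≤ δ12₃) (hρδ : ρ + σ ≤ δK12)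
    (hα0 : 0 < α) (hα1 : α < 1) (hBd : ∀ ε, 0 < ε → ε ≤ 1 → 0 ≤ Bd ε) (hBd2 : ∀ ε β, 0 < ε → ε ≤ 1 → 0 ≤ β → β < 1 → 0 ≤ Bd2 ε β)
    (hCev : 0 ≤ Cev)
    -- ======== the TEN K-free EVALUATION ROWS (replace the kernel family `GG` and its six co-reading rows) ========
    (hoff : ∀ (i : KIdx 2 ℓ hd3 hL 1 1) (lam : (geo9K i).Loc) (y' : (geo9K i).Site), (geo9K i).suppIn lam y' →
      ∀ x : X i, ¬ RelB i ((𝔬12 i).blk x) y' → ev i lam x = 0)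
    (hoffY : ∀ (i : KIdx 2 ℓ hd3 hL 1 1) (lam : (geo9K i).Loc) (y' : (geo9K i).Site), (geo9K i).suppIn lam y' →
      ∀ w : Y i, ¬ RelB i ((𝔬12 i).blkY w) y' → evY i lam w = 0)
    (hbd : ∀ (i : KIdx 2 ℓ hd3 hL 1 1) (lam : (geo9K i).Loc) (x : X i), |ev i lam x| ≤ (geo9K i).supNorm lam)
    (hbdY : ∀ (i : KIdx 2 ℓ hd3 hL 1 1) (lam : (geo9K i).Loc) (w : Y i), |evY i lam w| ≤ (geo9K i).supNorm lam)
    (hwb : ∀ (i : KIdx 2 ℓ hd3 hL 1 1) (lam : (geo9K i).Loc) (γ : ℝ) (x : X i), |ev i lam x| ≤ (geo9K i).len ((𝔬12 i).blk x) ^ γ * (geo9K i).wNorm γ lam)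
    (hwbY : ∀ (i : KIdx 2 ℓ hd3 hL 1 1) (lam : (geo9K i).Loc) (γ : ℝ) (w : Y i), |evY i lam w| ≤ (geo9K i).len ((𝔬12 i).blkY w) ^ γ * (geo9K i).wNorm γ lam)
    (hl2b : ∀ (i : KIdx 2 ℓ hd3 hL 1 1) (lam : (geo9K i).Loc) (y' y'' : (geo9K i).Site), (geo9K i).suppIn lam y' → RelB i y'' y' →
      bl2 (g := toB6 (geo9K i) 1 (H i)) (𝔬12 i).blk y'' (ev i lam) ≤ Cev * (geo9K i).l2Norm lam)
    (hl2bY : ∀ (i : KIdx 2 ℓ hd3 hL 1 1) (lam : (geo9K i).Loc) (y' y'' : (geo9K i).Site), (geo9K i).suppIn lam y' → RelB i y'' y' →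
      bl2 (g := toB6 (geo9K i) 1 (H i)) (𝔬12 i).blkY y'' (evY i lam) ≤ Cev * (geo9K i).l2Norm lam)
    (hloc : ∀ (i : KIdx 2 ℓ hd3 hL 1 1) (ε : ℝ) (lam : (geo9K i).Loc) (y' : (geo9K i).Site), (geo9K i).suppInT lam y' → (bHXA i ε).IsLoc y' (ev i lam))
    (hlocle : ∀ (i : KIdx 2 ℓ hd3 hL 1 1) (ε : ℝ) (lam : (geo9K i).Loc) (y' : (geo9K i).Site), (geo9K i).suppInT lam y' →
      (bHXA i ε).loc y' (ev i lam) ≤ (geo9K i).holder ε lam + (geo9K i).supNorm lam)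
    -- ======== the LETTER-SYMMETRY ROW (replaces `hsymGG`) ========
    (hls : ∀ i : KIdx 2 ℓ hd3 hL 1 1, M12 ≤ (geo9K i).M → ∀ α₀ : ℝ, 0 < α₀ → (geo9K i).M * α₀ ≤ a12 →
      ∀ U : (bgT3 i).Cfg, (bgT3 i).Reg335 c35 α₀ U → (bgT3 i).Reg336 c35 α₀ U →
        IsTransposePair ((𝔬12 i).S0 U) ((𝔬12 i).S0 U) ∧ IsTransposePair ((𝔬12 i).Tpi U) ((𝔬12 i).Tpi U) ∧
          IsTransposePair ((𝔬12 i).T2 U) ((𝔬12 i).T2 U) ∧ IsTransposePair ((𝔬12 i).D U) ((𝔬12 i).Dstar U))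
    (wZ : ∀ x : KIdx 2 ℓ hd3 hL 1 1, (geo9K x).Site → ℝ) (hwZ : ∀ x y, 0 < wZ x y)
    (hletters : LettersRowZT3 𝔬12 (fun _ => 1) H wZ hwZ c35 a12 M12 B12₃ δ12₃)
    (hlettersD : ∀ x : KIdx 2 ℓ hd3 hL 1 1, M12 ≤ (geo9K x).M → ∀ α₀ : ℝ, 0 < α₀ → (geo9K x).M * α₀ ≤ a12 →
      ∀ U : (bgT3 x).Cfg, (bgT3 x).Reg335 c35 α₀ U → (bgT3 x).Reg336 c35 α₀ U →
        Letters313DZ (𝔬12 x) 1 (H x) (geoOK_geo9K x) (wZ x) (hwZ x) B12₃ δ12₃ (bH13 x) U ∧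
          Letters313DMZ (𝔬12 x) (𝔭A x) (𝔡A x).Dd 1 (H x) (geoOK_geo9K x) (wZ x) (hwZ x) B12₃ Bq12 δ12₃ (bH13 x) U)
    (hLHH : ∀ x : KIdx 2 ℓ hd3 hL 1 1, M12 ≤ (geo9K x).M → ∀ α₀ : ℝ, 0 < α₀ → (geo9K x).M * α₀ ≤ a12 →
      ∀ U : (bgT3 x).Cfg, (bgT3 x).Reg335 c35 α₀ U → (bgT3 x).Reg336 c35 α₀ U →
        LettersHHZ (𝔬12 x) (𝔭A x) 1 (H x) (geoOK_geo9K x).lenle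
          (weightNorm (BlockNorm.ofBlocks (toB6 (geo9K x) 1 (H x)) (𝔬12 x).blkZ) (wZ x) fun y => (hwZ x y).le) Bq12 δ12₃ U)
    (hLH3 : ∀ x : KIdx 2 ℓ hd3 hL 1 1, M12 ≤ (geo9K x).M → ∀ α₀ : ℝ, 0 < α₀ → (geo9K x).M * α₀ ≤ a12 →
      ∀ U : (bgT3 x).Cfg, (bgT3 x).Reg335 c35 α₀ U → (bgT3 x).Reg336 c35 α₀ U →
        Letters313HZ (𝔬12 x) (𝔭A x) 1 (H x) (geoOK_geo9K x) (wZ x) (hwZ x) (bH13 x) BhD13 Bx13 δ12₃ U)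
    (vZ : ∀ x : KIdx 2 ℓ hd3 hL 1 1, (geo9K x).Site → ℝ) (hvZ : ∀ x y, 0 < vZ x y)
    (hLL2 : ∀ x : KIdx 2 ℓ hd3 hL 1 1, M12 ≤ (geo9K x).M → ∀ α₀ : ℝ, 0 < α₀ → (geo9K x).M * α₀ ≤ a12 →
      ∀ U : (bgT3 x).Cfg, (bgT3 x).Reg335 c35 α₀ U → (bgT3 x).Reg336 c35 α₀ U →
        Letters313L2PZ (𝔬12 x) (𝔡A x).Dd (𝔡A x).Dsd 1 (H x) B₄ δ12₃ (vZ x) (hvZ x) U ∧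
          Letters313L2MZ (𝔬12 x) (𝔡A x).Dd (𝔡A x).Dsd 1 (H x) B₄ δ12₃ (vZ x) (hvZ x) U)
    (hLIM : ∀ x : KIdx 2 ℓ hd3 hL 1 1, M12 ≤ (geo9K x).M → ∀ α₀ : ℝ, 0 < α₀ → (geo9K x).M * α₀ ≤ a12 →
      ∀ U : (bgT3 x).Cfg, (bgT3 x).Reg335 c35 α₀ U → (bgT3 x).Reg336 c35 α₀ U →
        Letters313IMB (𝔬12 x) (𝔭A x) (𝔡A x).Dd (𝔡A x).Dsd 1 (H x) (geoOK_geo9K x).lenle (bHXA x) (bHW13 x) Br (fun ε => θV ε * ((geo9K x).M * α₀))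
          Bd Bd2 δ12₃ δK12 U)
    -- ======== the class-transfer row in the ∃-shape (BG-336)′ of ✓`Prop7SectET3ClassTransferRows` (discharged by `reg335_reg336_T3_of_regPr` for `c35 ≥ c35₀(L)`), the normed family, its weight pin and the readout row ========
    (hCTS : ∃ a₅ : ℝ, 0 < a₅ ∧ ∀ (hℓ : 4 ≤ ℓ) (m : ℕ) (hm : 1 ≤ m) (n K a' R : ℕ) (hk1 : 1 ≤ K - n) (hsize : a' + 3 ≤ m + n) (hM8 : 8 ≤ (ℓ + 1) ^ a')
      (hR2 : 2 * (ℓ + 1) ^ 2 ≤ R) (α₀ : ℝ), 0 < α₀ → ((ℓ + 1 : ℕ) : ℝ) * (((ℓ + 1) ^ a' : ℕ) : ℝ) * α₀ ≤ a₅ →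
      ∀ U₀ : GaugeField (PV 2 ℓ m K hd3 hL) 0 (Matrix.specialUnitaryGroup (Fin 2) ℂ), RegPr (⟨ℓ + 1, hL, m, hm⟩ : T3Family) n K α₀ U₀ →
        (bgT3 (memberIdx ℓ hL hℓ m hm n K a' R hk1 hsize hM8 hR2)).Reg335 c35 α₀ (cfgV1OfT3 U₀) ∧
          (bgT3 (memberIdx ℓ hL hℓ m hm n K a' R hk1 hsize hM8 hR2)).Reg336 c35 α₀ (cfgV1OfT3 U₀))
    {Xo Yo : ∀ i : KIdx 2 ℓ hd3 hL 1 1, (bgT3 i).Cfg → Type} [∀ i U, SeminormedAddCommGroup (Xo i U)] [∀ i U, SeminormedAddCommGroup (Yo i U)]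
    (Gop : ∀ (i : KIdx 2 ℓ hd3 hL 1 1) (U : (bgT3 i).Cfg), Xo i U → Yo i U) (ιo : ∀ (i : KIdx 2 ℓ hd3 hL 1 1) (U : (bgT3 i).Cfg), Xo i U → (geo9K i).Loc)
    (hw : ∀ (i : KIdx 2 ℓ hd3 hL 1 1) (U : (bgT3 i).Cfg) (f : Xo i U), (geo9K i).wNorm (-3) (ιo i U f) ≤ ‖f‖)
    (hread : ∀ (i : KIdx 2 ℓ hd3 hL 1 1) (U : (bgT3 i).Cfg) (f : Xo i U) (C : ℝ), 0 ≤ C →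
      (∀ x : X i, |(𝔬12 i).GG U (ev i (ιo i U f)) x| ≤ C * B9.pref4 ((geo9K i).len ((𝔬12 i).blk x)) 0 * (geo9K i).len ((𝔬12 i).blk x) ^ (-3 : ℝ)) →
      (∀ w : Y i, |((𝔬12 i).D U ∘ₗ (𝔬12 i).GG U) (ev i (ιo i U f)) w| ≤ C * B9.pref4 ((geo9K i).len ((𝔬12 i).blkY w)) 1 * (geo9K i).len ((𝔬12 i).blkY w) ^ (-3 : ℝ)) →
        ‖Gop i U f‖ ≤ C) :
    ∃ M₄ a₀ B₀' : ℝ, 0 < M₄ ∧ 0 < a₀ ∧ 0 < B₀' ∧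
      ∀ (hℓ : 4 ≤ ℓ) (m : ℕ) (hm : 1 ≤ m) (n K a' R : ℕ) (hk1 : 1 ≤ K - n) (hsize : a' + 3 ≤ m + n) (hM8 : 8 ≤ (ℓ + 1) ^ a') (hR2 : 2 * (ℓ + 1) ^ 2 ≤ R),
        M₄ ≤ ((ℓ + 1 : ℕ) : ℝ) * (((ℓ + 1) ^ a' : ℕ) : ℝ) →
        ∀ (e : ℝ) (U₀ : GaugeField (PV 2 ℓ m K hd3 hL) 0 (Matrix.specialUnitaryGroup (Fin 2) ℂ)),
          RegPr (⟨ℓ + 1, hL, m, hm⟩ : T3Family) n K e U₀ → e ≤ a₀ / (((ℓ + 1 : ℕ) : ℝ) * (((ℓ + 1) ^ a' : ℕ) : ℝ)) →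
            ∀ f : Xo (memberIdx ℓ hL hℓ m hm n K a' R hk1 hsize hM8 hR2) (cfgV1OfT3 U₀),
              ‖Gop (memberIdx ℓ hL hℓ m hm n K a' R hk1 hsize hM8 hR2) (cfgV1OfT3 U₀) f‖ ≤ B₀' * ‖f‖ := by
  -- the face-E G₀ layer: Thm33G0, the two Steps, LeftStep (θ_D chosen), FormSmall (r₁₂ chosen), Identities, the G₀ direction rows, in (M₀, a₀)
  obtain ⟨B12₀, Bh12, Bi12, Bi2₁₂, B12₂, θ12, θD, r12, M₀, a₀, hB12₀, hBh12, hBi12, hBi2₁₂, hB12₂, hθ12, hθD, hr12, hM₀, ha₀, hMM, haa,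
      hmodel12, hleft12, hG0C⟩ :=
    g0_layer_T3_of_thm310_coreB (bg := bgT3) (P := fun _ => P) hc35 q hq q3 hq3 qM hqM H 𝔬A 𝔭A 𝔡A bHXA κA SHA S3A SIA SMA S2A hstA hκA h36A h36HA
      h36A2 hcntHA hcnt3A hcntIA hcntMA hcnt2A hsymA htrA 𝔬12 hblk hblkY hG0 hD hDs θ2₁₂ δ12₀ δK12 a12 M12 B12₃ δ12₃ t12 δT12 ρS σS κ₀ ha12 hM12
      hθ2₁₂ hδ12₀ hB12₃ ht12 bH13 hκ13 hσS hρS hρST hρS₀ hρS₃ hδKS hσSK hpos12 hinv12 hIdOfForm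
      (fun x hM α₀ hα hMa U hU hU' => (hletters x hM α₀ hα hMa U hU hU').gD2) Ta Ta₂ Tb Tb₂ hL3131 hL3131H
      (fun x hM α₀ hα hMa U hU hU' => (hlettersD x hM α₀ hα hMa U hU hU').1.dgDH) hstepL2
  -- the StepDir layer at `Rel := RelB` (multiplicity 6): LeftStep re-issued at θ_D′ ≥ θ_D, StepDirB with θ_H(β), θ_I(ε), StepL2 passed through, in (M₀′, a₀)
  obtain ⟨θD', θH, θI, M₀', hθD', hθH, hθI, hM₀', hleft', hstepC'⟩ :=
    stepDirB_layer_T3_of_lettersCZ (bg := bgT3) (P := fun _ => P) q hq H 𝔭A (fun x => (𝔡A x).Dd) (fun x => (𝔡A x).Dsd) bHXA 𝔬12 bH13 κ₀ hκ13 bHW13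
      (fun x => geoOK_geo9K x) B12₀ δ12₀ δK12 B12₃ δ12₃ t12 δT12 ρS σS θD θ2₁₂ M₀ a₀ M12 a12 Bh12 Bi12 Bq12 BhD13 Bx13 Bx0 BdX BiD BdD Bi2₁₂
      hB12₀ hB12₃ ht12 hθD hM₀ hMM haa hBh12 hBhD13 hBx13 hBx0 hBdX hBiD hσS hρST hρS₀ hρS₃ hδK0 hδKS hleft12
      (fun x hM α₀ hα hMa U hU hU' => (hG0C x hM α₀ hα hMa U hU hU').1) (fun x hM α₀ hα hMa U hU hU' => (hG0C x hM α₀ hα hMa U hU hU').2.1)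
      wZ hwZ hLH3 (fun x hM α₀ hα hMa U hU hU' => (hlettersD x hM α₀ hα hMa U hU hU').2) hX hdiv
      (fun x => RelB x) 6 (by norm_num) (fun x y' => relB_mult_real x y') (fun x a b b' h => dist_eq_of_relB_right x a b b' h)
      hvanishX hleX Ta Ta₂ Ta' Ta₂' Tb Tb₂ Tb' Tb₂' hL3131 hL3131H hR hstepL2
  have hM12' : M12 ≤ M₀' := hMM.trans hM₀'
  have hM₀pos' : 0 < M₀' := lt_of_lt_of_le hM₀ hM₀'
  -- (1) the canonical kernel family, member by member (F2)
  have hK := fun i : KIdx 2 ℓ hd3 hL 1 1 =>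
    exists_kernelFamily_structural (R := (1 : ℝ)) (H := H i) (𝔬12 i).GG (𝔬12 i).D (𝔬12 i).Dstar (𝔡A i).Dd (𝔡A i).Dsd (𝔭A i) (bHXA i) (𝔬12 i).blk (𝔬12 i).blkY (ev i) (evY i)
      (RelB i) r Cev (fun _ _ _ => 0) (fun _ _ _ => 0) (hoff i) (hoffY i) (hbd i) (hbdY i) (hwb i) (hwbY i) (hl2b i) (hl2bY i) (hloc i) (hlocle i)
      (modelSignsOn_geo9K i).supNorm_nonneg (modelSignsOn_geo9K i).l2Norm_nonneg (modelSignsOn_geo9K i).cutSup_nonneg (modelSignsOn_geo9K i).cutH_nonneg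
      (modelSignsOn_geo9K i).holder_nonneg (geoOK_geo9K i).lenpos
  choose GG _h3 _hg3 hcoR hco1R hcoG hl2N hH1N hIF _hd0 _hd1 _hd2 _hd4 hgd0 hgd1 _hgd2 hsg using hK
  -- (2) the symmetry row (F1) from the `Identities` conjunct of the DERIVED `hmodel` (face-E layer) and the letter symmetries, at (M₀′, a₀)
  have hsymGG := hsymGG_row_of_letterSymm 𝔬12 c35 a₀ M₀'
    (fun i hM α₀ hα hMa U h5 h6 => (hmodel12 i (hM₀'.trans hM) α₀ hα hMa U h5 h6).2.2.2.2)
    (fun i hM α₀ hα hMa U h5 h6 => hls i (hM12'.trans hM) α₀ hα (hMa.trans haa) U h5 h6)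
  -- (3) the (3.47) pin from the dominations and the readout row
  have hglob : ∀ (i : KIdx 2 ℓ hd3 hL 1 1) (U : (bgT3 i).Cfg) (f : Xo i U),
      ‖Gop i U f‖ ≤ max ((GG i).glob 0 U (ιo i U f) (-3)) ((GG i).glob 1 U (ιo i U f) (-3)) := by
    intro i U f
    have h0 := (hsg i U (ιo i U f)).2.1 (-3)
    have hpl : ∀ (y : (geo9K i).Site) (n : Fin 4), 0 ≤ B9.pref4 ((geo9K i).len y) n * (geo9K i).len y ^ (-3 : ℝ) := fun y n =>
      mul_nonneg (B9FromB6.pref4_nonneg ((geoOK_geo9K i).lenpos y).le n) (Real.rpow_nonneg ((geoOK_geo9K i).lenpos y).le _)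
    refine hread i U f _ (le_max_of_le_left h0.1) (fun x => (hgd0 i U (ιo i U f) (-3) x).trans ?_) (fun w => (hgd1 i U (ιo i U f) (-3) w).trans ?_)
    · rw [mul_assoc, mul_assoc]
      exact mul_le_mul_of_nonneg_right (le_max_left _ _) (hpl _ 0)
    · rw [mul_assoc, mul_assoc]
      exact mul_le_mul_of_nonneg_right (le_max_right _ _) (hpl _ 1)
  -- (4) the leaf of record, read at (M₀′, a₀) with the layers' constants and the chosen kernel family, then (BG-336)′
  exact normG_row_of_t313_classTransferS
    (t313_of_pins_T3_completePairMBZ 𝔬12 H GG bH13 𝔭A bHXA (fun x => (𝔡A x).Dd) (fun x => (𝔡A x).Dsd) bHW13 ev evY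
    r Cev θ12 θD' θ2₁₂ r12 B12₀ B12₂ B₄ δ12₀ δK12 σ ρ a₀ M₀' B12₃ δ12₃ ρ' α κ₀ Bh12 Bi12 Bq12 BhD13 Bx13 Bd θH θI θV Br Bi2₁₂ Bd2
    hθ12 hθD' hθH hθI hθ2₁₂ hθV hr12 hB12₀ hB12₂ hB12₃ hB₄ hBr hσ hρ' hρ'ρ hρ'ρ₅ hσρ' hρ0 hρ₃ hρδ ha₀ hM₀pos' hα0 hα1 hBi12 hBd hBi2₁₂ hBd2
    hBh12 hBq12 hBhD13 hBx13 hCev hκ13 hκW hcoR hco1R hcoG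
    hsymGG hl2N hH1N hIF
    (fun x hM α₀ hα hMa U hU hU' => hmodel12 x (hM₀'.trans hM) α₀ hα hMa U hU hU')
    (fun x hM α₀ hα hMa U hU hU' => hleft' x hM α₀ hα hMa U hU hU') wZ hwZ
    (fun x hM α₀ hα hMa U hU hU' => hletters x (hM12'.trans hM) α₀ hα (hMa.trans haa) U hU hU')
    (fun x hM α₀ hα hMa U hU hU' => hlettersD x (hM12'.trans hM) α₀ hα (hMa.trans haa) U hU hU')
    (fun x hM α₀ hα hMa U hU hU' => ⟨(hG0C x (hM₀'.trans hM) α₀ hα hMa U hU hU').1, (hG0C x (hM₀'.trans hM) α₀ hα hMa U hU hU').2.1⟩)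
    (fun x hM α₀ hα hMa U hU hU' => (hstepC' x hM α₀ hα hMa U hU hU').1)
    (fun x hM α₀ hα hMa U hU hU' => hLHH x (hM12'.trans hM) α₀ hα (hMa.trans haa) U hU hU')
    (fun x hM α₀ hα hMa U hU hU' => hLH3 x (hM12'.trans hM) α₀ hα (hMa.trans haa) U hU hU')
    (fun x hM α₀ hα hMa U hU hU' => (hG0C x (hM₀'.trans hM) α₀ hα hMa U hU hU').2.2)
    (fun x hM α₀ hα hMa U hU hU' => (hstepC' x hM α₀ hα hMa U hU hU').2) vZ hvZ
    (fun x hM α₀ hα hMa U hU hU' => hLL2 x (hM12'.trans hM) α₀ hα (hMa.trans haa) U hU hU')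
    (fun x hM α₀ hα hMa U hU hU' => hLIM x (hM12'.trans hM) α₀ hα (hMa.trans haa) U hU hU')
      (fun x => HasRWExpOfOps (𝔬12 x)) (fun x => PosDefKOfOps (𝔬12 x)) (fun _ => rfl) (fun _ => rfl))
    hCTS Gop ιo hw hglob

end Summit.QuantumFields.YangMills.Theorems.Prop7SectET3N06LeavesRecordStepLayerEvalRowsS

end
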